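import Summits.ResolutionOfSingularities.ResolutionOfSingularities.Theorems.PurelyInseparableDim4ResConeLightTripleTail
import Summits.ResolutionOfSingularities.ResolutionOfSingularities.Theorems.PurelyInseparableDim4ResConeStretchLedger
import Summits.ResolutionOfSingularities.ResolutionOfSingularities.Theorems.PurelyInseparableDim4IsolatedHasseLedger
import HarnessLib
import HarnessLib.Audit.Tags

/-!
# Purely inseparable four-folds — the LIGHT TRIPLE TAIL, part 4 (K25d): the ENTRY — three stretch-born boundary
# letters give the triple-merged Hasse ledger, hence no infinite isolated chain (K2(p) lane, slice B, A∞)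

[OURS · counted 0 · cell `res-dim4-pi` · K2(p) lane holder res-dim4-p-12 g3, brick (K25) «A∞(T) ASSEMBLY» and its
entry glue from idea-4 g3's trichotomy (T3) (bus 2026-08-29 01:15Z; typed by res-dim4-p-9 g3 as K26), seat
res-dim4-p-2 g4 (lineage res-dim4-p-2).]  Nothing here proves K2(p)/K2(5) (the light regime stays OPEN: the
trichotomy K26, the two-slot class C∞ = K24 and the `d = 3` residual packaging K27 are separate), `NoIsolatedTrap p p`
or resolution of singularities in dimension ≥ 4 / characteristic `p`.  AI kernel work, weaker than expert review.

THE CLAIM (`no_light_triple_regime_of_born`).  On an isolated above-floor `Step0 p` chain with witnesses `(j, b)`,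
`x^{r₀} ∣ F₀`, constant shade `d = 3 < p` and frame data from `k₀` on, with exactly three boundary letters at every
stage (`(c k).r.support.card = 3`, K26's hypothesis) and the light bound `p ≤ r_X + r_Y + 3` from `k₁ ≥ k₀` on: if
from `k₁` on every boundary letter is STRETCH-BORN and kept since its birth (idea-4's (T3):
`∃ t, k₀ ≤ t < k ∧ j t = i ∧ ∀ m ∈ (t, k), j m ≠ i ∧ b m i = 0`), then `False`.
Route at the stage `k₁` (alive letters `N, μ, ν`, free letter `e`): res-dim4-typ-1 g2's K13b
`contactSupport_not_subset_pair` on the three pairs + the direction equation + three letters at `k₁ + 1` give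
`ℓ_{k₁}(e) ≠ 0`; res-dim4-p-2 g3's K11 `stretch_ledger` gives the three generic one-letter ledgers with
`coeff_{x_e} h_a ≠ 0`; res-dim4-p-12 g3's K8 `exists_unit_mul_mem_span_X_hasseDeriv_pow_of_mem` converts them to
the COMMON Hasse contact polynomial `H = D_e^{(d−1)} G`; K2 `mem_span_mul_of_mem_span_of_mem_span` and
res-dim4-p-9 g3's K22 (i) `mem_span_mul3_of_mem` merge (`H ∉ (x_a, x_b)` by `hasseDeriv_powerCone_not_mem_span_X_pair`)
to `U·G = S·x_N x_μ x_ν + T·H^d` with `lin H = (a₀ d ℓ_e^{d−1})·L` EXACT (res-dim4-p-3 g3's K16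
`homogeneousComponent_one_hasseDeriv_powerCone`); the step at `k₁` loses exactly one of `N, μ, ν` (three letters at
`k₁ + 1`), the other two are kept — and part 3's `no_light_triple_tail` ends the chain.  At `p = 5` the light bound
is automatic: `no_light_triple_regime_of_born_five`.
bears_on: LADDER-RESOLUTION:D157-DOOR2 (res-dim4-pi · K2(p) · slice B · K25d).  Supports
stmt-ResolutionOfSingularities-16155 (helper).
-/

set_option linter.dupNamespace false -- mandated namespace of this single-conjunct summit

noncomputable section

namespace Summit.ResolutionOfSingularities.ResolutionOfSingularities.Theorems.PIDim4

namespace ResCone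

open MvPolynomial Finset
open Literature.AlgebraicGeometry.Resolution
open Literature.AlgebraicGeometry.Resolution.CentreBlowup
open Literature.AlgebraicGeometry.Resolution.Hauser2010
open Literature.AlgebraicGeometry.Resolution.HauserPerlega2019
open PointBlowup (polarMap additiveSubspace direction)

variable {K : Type} [Field K]

/-! ## 1. One loss per step, from three boundary letters before and after -/

/-- **Two of the three alive letters are kept**: if the new alive set `S′ = {j} ∪ {i ∈ {X, Y, Z} | b i = 0}` has three
elements (`X, Y, Z, e` pairwise distinct), then a chart `j = X` keeps `Y` and `Z`, and the free chart `j = e` translates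
exactly one of `X, Y, Z` — here: not none, and if `X` then neither `Y` nor `Z`. [folklore] -/
theorem two_kept_of_law {S' : Finset (Fin 4)} {jk X Y Z e : Fin 4} {bk : Fin 4 → K} (hXY : X ≠ Y) (hXZ : X ≠ Z)
    (hYZ : Y ≠ Z) (heX : e ≠ X) (heY : e ≠ Y) (heZ : e ≠ Z)
    (hlaw : ∀ i, i ∈ S' ↔ i = jk ∨ (i ∈ ({X, Y, Z} : Finset (Fin 4)) ∧ bk i = 0)) (hcard : S'.card = 3) :
    (jk = X → bk Y = 0 ∧ bk Z = 0) ∧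
      (jk = e → ¬ (bk X = 0 ∧ bk Y = 0 ∧ bk Z = 0) ∧ (bk X ≠ 0 → bk Y = 0 ∧ bk Z = 0)) := by
  classical
  have hmem : ∀ i, i ∈ ({X, Y, Z} : Finset (Fin 4)) ↔ i = X ∨ i = Y ∨ i = Z := fun i => by
    simp only [Finset.mem_insert, Finset.mem_singleton]
  -- the new alive set never fits into two letters
  have hle2 : ∀ A₁ A₂ : Fin 4, (∀ i, i ∈ S' → i = A₁ ∨ i = A₂) → False := by
    intro A₁ A₂ hsub
    have hsub' : S' ⊆ ({A₁, A₂} : Finset (Fin 4)) := fun i hi => by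
      rw [Finset.mem_insert, Finset.mem_singleton]; exact hsub i hi
    have h1 := Finset.card_le_card hsub'
    have h2 : (({A₁, A₂} : Finset (Fin 4))).card ≤ 2 := Finset.card_le_two
    omega
  -- membership in the new alive set, unfolded
  have hS : ∀ i, i ∈ S' → i = jk ∨ ((i = X ∨ i = Y ∨ i = Z) ∧ bk i = 0) := fun i hi => by
    have h1 := (hlaw i).mp hi
    rw [hmem] at h1
    exact h1
  refine ⟨fun hjX => ⟨?_, ?_⟩, fun hje => ⟨?_, fun hbX => ⟨?_, ?_⟩⟩⟩
  · by_contra hY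
    refine hle2 X Z fun i hi => ?_
    rcases hS i hi with h1 | ⟨h1 | h1 | h1, h2⟩
    · exact Or.inl (h1.trans hjX)
    · exact Or.inl h1
    · exact absurd h2 (h1 ▸ hY)
    · exact Or.inr h1
  · by_contra hZ
    refine hle2 X Y fun i hi => ?_
    rcases hS i hi with h1 | ⟨h1 | h1 | h1, h2⟩
    · exact Or.inl (h1.trans hjX)
    · exact Or.inl h1
    · exact Or.inr h1
    · exact absurd h2 (h1 ▸ hZ)
  · rintro ⟨hbX, hbY, hbZ⟩
    have hsub : ({e, X, Y, Z} : Finset (Fin 4)) ⊆ S' := by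
      intro i hi
      rw [hlaw, hmem]
      simp only [Finset.mem_insert, Finset.mem_singleton] at hi
      rcases hi with h1 | h1 | h1 | h1
      · exact Or.inl (h1.trans hje.symm)
      · exact Or.inr ⟨Or.inl h1, h1 ▸ hbX⟩
      · exact Or.inr ⟨Or.inr (Or.inl h1), h1 ▸ hbY⟩
      · exact Or.inr ⟨Or.inr (Or.inr h1), h1 ▸ hbZ⟩
    have h1 := Finset.card_le_card hsub
    rw [← univ_eq_of_four heX heY heZ hXY hXZ hYZ, Finset.card_univ, Fintype.card_fin] at h1
    omega
  · by_contra hY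
    refine hle2 e Z fun i hi => ?_
    rcases hS i hi with h1 | ⟨h1 | h1 | h1, h2⟩
    · exact Or.inl (h1.trans hje)
    · exact absurd h2 (h1 ▸ hbX)
    · exact absurd h2 (h1 ▸ hY)
    · exact Or.inr h1
  · by_contra hZ
    refine hle2 e Y fun i hi => ?_
    rcases hS i hi with h1 | ⟨h1 | h1 | h1, h2⟩
    · exact Or.inl (h1.trans hje)
    · exact absurd h2 (h1 ▸ hbX)
    · exact Or.inr h1
    · exact absurd h2 (h1 ▸ hZ)

/-! ## 2. The entry -/

section Chain

variable (p : ℕ) [hp : Fact p.Prime] [CharP K p] [DecidableEq K]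

/-- **NO LIGHT TRIPLE REGIME** (K25d, the A∞ entry; statement in the module docstring): three stretch-born boundary
letters on a light slice-B stretch (`d = 3`, three boundary letters at every stage) give the triple-merged Hasse
ledger at once, and `no_light_triple_tail` ends the chain. [OURS]
[cite: CossartJannsenSaito2020, Thm. 3.10(4), Thm. 3.14, Thm. 9.3] -/
theorem no_light_triple_regime_of_born {c : ℕ → State K} {j : ℕ → Fin 4} {b : ℕ → Fin 4 → K}
    (hc : ∀ k, IsIsolated p (c k).F ∧ Step0 p (c k) (c (k + 1))) (hw : FreeTail.IsWitnessedChain p c j b)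
    (hr0 : ∀ e ∈ (c 0).F.support, (c 0).r ≤ e) (hfloor : ∀ k, ordZero (c k).F ≠ p) {k₀ d : ℕ} (hd3 : d = 3)
    (hdp : d < p) (hshade : ∀ k, k₀ ≤ k → (c k).shade = (d : ℕ∞)) {ℓ : ℕ → Fin 4 → K} {a0 lam : ℕ → K}
    (hform : ∀ k, k₀ ≤ k → resForm (c k) = C (a0 k) * (∑ i, C (ℓ k i) * X i) ^ d)
    (hdir : ∀ k, k₀ ≤ k → ℓ k (j k) + dotProduct (ℓ k) (b k) = 0) (hlam : ∀ k, k₀ ≤ k → lam k ≠ 0)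
    (hprop : ∀ k, k₀ ≤ k → ∀ i, i ≠ j k → ℓ (k + 1) i = lam k * ℓ k i)
    (hcarry : ∀ k, k₀ ≤ k → ∃ i, i ≠ j k ∧ ℓ k i ≠ 0)
    (hB3 : ∀ k, k₀ ≤ k → (c k).r.support.card = 3) {k₁ : ℕ} (hk₁ : k₀ ≤ k₁)
    (hw3 : ∀ k, k₁ ≤ k → ∀ i₁ i₂ : Fin 4, i₁ ≠ i₂ → 1 ≤ (c k).r i₁ → 1 ≤ (c k).r i₂ →
      p ≤ (c k).r i₁ + (c k).r i₂ + 3)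
    (hT3 : ∀ k, k₁ ≤ k → ∀ i, 1 ≤ (c k).r i →
      ∃ t, k₀ ≤ t ∧ t < k ∧ j t = i ∧ ∀ m, t < m → m < k → j m ≠ i ∧ b m i = 0) : False := by
  classical
  have hd2 : 2 ≤ d := by omega
  have hd1 : 1 ≤ d := by omega
  have hbj : ∀ k, b k (j k) = 0 := fun k => (hw k).2.1
  -- the three alive letters at `k₁` and the free fourth letter
  obtain ⟨N, μ, ν, hNμ, hNν, hμν, hsupp⟩ := Finset.card_eq_three.mp (hB3 k₁ hk₁)
  have hmem3 : ∀ i, i ∈ (c k₁).r.support ↔ i = N ∨ i = μ ∨ i = ν := fun i => by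
    rw [hsupp]; simp only [Finset.mem_insert, Finset.mem_singleton]
  have halive : ∀ i, 1 ≤ (c k₁).r i ↔ i ∈ (c k₁).r.support := fun i => by
    rw [Finsupp.mem_support_iff]; omega
  obtain ⟨e, -, he⟩ := Finset.exists_mem_notMem_of_card_lt_card (s := (c k₁).r.support)
    (t := (Finset.univ : Finset (Fin 4))) (by rw [hB3 k₁ hk₁, Finset.card_univ, Fintype.card_fin]; norm_num)
  have heN : e ≠ N := fun h => he ((hmem3 e).mpr (Or.inl h))
  have heμ : e ≠ μ := fun h => he ((hmem3 e).mpr (Or.inr (Or.inl h)))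
  have heν : e ≠ ν := fun h => he ((hmem3 e).mpr (Or.inr (Or.inr h)))
  have hre : (c k₁).r e = 0 := by rwa [Finsupp.mem_support_iff, not_not] at he
  have hrN : 1 ≤ (c k₁).r N := (halive N).mpr ((hmem3 N).mpr (Or.inl rfl))
  have hrμ : 1 ≤ (c k₁).r μ := (halive μ).mpr ((hmem3 μ).mpr (Or.inr (Or.inl rfl)))
  have hrν : 1 ≤ (c k₁).r ν := (halive ν).mpr ((hmem3 ν).mpr (Or.inr (Or.inr rfl)))
  have hcov : ∀ i : Fin 4, i = N ∨ i = μ ∨ i = ν ∨ i = e := fun i => by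
    have h1 := Finset.mem_univ i
    rw [univ_eq_of_four hNμ hNν heN.symm hμν heμ.symm heν.symm] at h1
    simpa [Finset.mem_insert, Finset.mem_singleton] using h1
  -- births (idea-4's (T3))
  obtain ⟨tN, htN0, htNk, hjtN, hkeptN⟩ := hT3 k₁ le_rfl N hrN
  obtain ⟨tμ, htμ0, htμk, hjtμ, hkeptμ⟩ := hT3 k₁ le_rfl μ hrμ
  obtain ⟨tν, htν0, htνk, hjtν, hkeptν⟩ := hT3 k₁ le_rfl ν hrν
  -- K13b on each pair of stretch-born kept letters, either birth order
  have hpair : ∀ {a a' : Fin 4} {ta ta' : ℕ}, a ≠ a' → k₀ ≤ ta → ta < k₁ → j ta = a →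
      (∀ m, ta < m → m < k₁ → j m ≠ a ∧ b m a = 0) → k₀ ≤ ta' → ta' < k₁ → j ta' = a' →
      (∀ m, ta' < m → m < k₁ → j m ≠ a' ∧ b m a' = 0) → ∃ m, m ≠ a ∧ m ≠ a' ∧ ℓ k₁ m ≠ 0 := by
    intro a a' ta ta' haa hta htak hja hka hta' hta'k hja' hka'
    subst hja; subst hja'
    rcases lt_trichotomy ta ta' with hlt | heq | hgt
    · exact contactSupport_not_subset_pair hdir hlam hprop hcarry hbj hta hlt hta'k hka hka'
    · exact absurd (congrArg j heq) haa
    · obtain ⟨m, h1, h2, h3⟩ := contactSupport_not_subset_pair hdir hlam hprop hcarry hbj hta' hgt htak hka' hka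
      exact ⟨m, h2, h1, h3⟩
  obtain ⟨m₁, hm₁N, hm₁μ, hm₁⟩ := hpair hNμ htN0 htNk hjtN hkeptN htμ0 htμk hjtμ hkeptμ
  obtain ⟨m₂, hm₂N, hm₂ν, hm₂⟩ := hpair hNν htN0 htNk hjtN hkeptN htν0 htνk hjtν hkeptν
  obtain ⟨m₃, hm₃μ, hm₃ν, hm₃⟩ := hpair hμν htμ0 htμk hjtμ hkeptμ htν0 htνk hjtν hkeptν
  -- the law of the step at `k₁`; three letters at `k₁ + 1`
  obtain ⟨o, ho, hpo, -, hod⟩ := chain_shade_nat p hc hfloor hshade hk₁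
  have hr := IsolatedBand.isolated_chain_forall_le hc hr0 k₁
  have hck := (hw k₁).2.2.2.2
  have hrstep := step_r_univ p (j k₁) (hbj k₁) (c k₁) ho hr
  rw [← hck] at hrstep
  have hlaw : ∀ i, i ∈ (c (k₁ + 1)).r.support ↔
      i = j k₁ ∨ (i ∈ ({N, μ, ν} : Finset (Fin 4)) ∧ b k₁ i = 0) := by
    intro i
    rw [← hsupp, Finsupp.mem_support_iff, Finsupp.mem_support_iff, hrstep, Finsupp.update_apply]
    by_cases hij : i = j k₁
    · rw [if_pos hij]
      constructor
      · intro _; exact Or.inl hij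
      · intro _; omega
    · rw [if_neg hij, Finsupp.filter_apply]
      constructor
      · intro h1
        by_cases hbi : b k₁ i = 0
        · rw [if_pos hbi] at h1; exact Or.inr ⟨h1, hbi⟩
        · rw [if_neg hbi] at h1; exact absurd rfl h1
      · rintro (h1 | ⟨h1, h2⟩)
        · exact absurd h1 hij
        · rw [if_pos h2]; exact h1
  have hcard' := hB3 (k₁ + 1) (by omega)
  have hlaw1 := two_kept_of_law hNμ hNν hμν heN heμ heν hlaw hcard'
  have hlaw2 := two_kept_of_law hNμ.symm hμν hNν heμ heN heν
    (fun i => by rw [Finset.insert_comm]; exact hlaw i) hcard'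
  have hlaw3 := two_kept_of_law hNν.symm hμν.symm hNμ heν heN heμ
    (fun i => by rw [Finset.insert_comm, Finset.pair_comm]; exact hlaw i) hcard'
  -- the direction equation at `k₁`
  have hdk := hdir k₁ hk₁
  have hdot : dotProduct (ℓ k₁) (b k₁) = ℓ k₁ N * b k₁ N + ℓ k₁ μ * b k₁ μ + ℓ k₁ ν * b k₁ ν + ℓ k₁ e * b k₁ e := by
    unfold dotProduct
    rw [sum_univ_of_four hNμ hNν heN.symm hμν heμ.symm heν.symm]
  rw [hdot] at hdk
  -- THE FREE LETTER CARRIES THE VERTEX FORM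
  have hℓe : ℓ k₁ e ≠ 0 := by
    intro hℓe0
    have hℓN : ℓ k₁ N ≠ 0 := by
      rcases hcov m₃ with h1 | h1 | h1 | h1
      · exact h1 ▸ hm₃
      · exact absurd h1 hm₃μ
      · exact absurd h1 hm₃ν
      · exact absurd hℓe0 (h1 ▸ hm₃)
    have hℓμ : ℓ k₁ μ ≠ 0 := by
      rcases hcov m₂ with h1 | h1 | h1 | h1
      · exact absurd h1 hm₂N
      · exact h1 ▸ hm₂
      · exact absurd h1 hm₂ν
      · exact absurd hℓe0 (h1 ▸ hm₂)
    have hℓν : ℓ k₁ ν ≠ 0 := by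
      rcases hcov m₁ with h1 | h1 | h1 | h1
      · exact absurd h1 hm₁N
      · exact absurd h1 hm₁μ
      · exact h1 ▸ hm₁
      · exact absurd hℓe0 (h1 ▸ hm₁)
    rw [hℓe0, zero_mul, add_zero] at hdk
    rcases hcov (j k₁) with hj | hj | hj | hj
    · obtain ⟨hbμ, hbν⟩ := hlaw1.1 hj
      have hbN : b k₁ N = 0 := by rw [← hj]; exact hbj k₁
      rw [hj, hbN, hbμ, hbν] at hdk
      exact hℓN (by linear_combination hdk)
    · obtain ⟨hbN, hbν⟩ := hlaw2.1 hj
      have hbμ : b k₁ μ = 0 := by rw [← hj]; exact hbj k₁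
      rw [hj, hbN, hbμ, hbν] at hdk
      exact hℓμ (by linear_combination hdk)
    · obtain ⟨hbN, hbμ⟩ := hlaw3.1 hj
      have hbν : b k₁ ν = 0 := by rw [← hj]; exact hbj k₁
      rw [hj, hbN, hbμ, hbν] at hdk
      exact hℓν (by linear_combination hdk)
    · rw [hj, hℓe0, zero_add] at hdk
      obtain ⟨hnot, hN1⟩ := hlaw1.2 hj
      by_cases hbN : b k₁ N = 0
      · by_cases hbμ : b k₁ μ = 0
        · have hbν : b k₁ ν ≠ 0 := fun h => hnot ⟨hbN, hbμ, h⟩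
          rw [hbN, hbμ] at hdk
          exact mul_ne_zero hℓν hbν (by linear_combination hdk)
        · obtain ⟨-, hbν⟩ := (hlaw2.2 hj).2 hbμ
          rw [hbN, hbν] at hdk
          exact mul_ne_zero hℓμ hbμ (by linear_combination hdk)
      · obtain ⟨hbμ, hbν⟩ := hN1 hbN
        rw [hbμ, hbν] at hdk
        exact mul_ne_zero hℓN hbN (by linear_combination hdk)
  -- the residual at `k₁`, its cone, and the three generic ledgers (K11)
  set G := (c k₁).F.divMonomial (c k₁).r with hGdef
  have hcone : homogeneousComponent d G = C (a0 k₁) * (∑ i, C (ℓ k₁ i) * X i) ^ d := by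
    have h1 := hform k₁ hk₁
    rw [resForm_eq_homogeneousComponent_divMonomial ho hr, hod] at h1
    exact h1
  have ha₀ : a0 k₁ ≠ 0 := ne_zero_of_resForm_eq_C_mul ho hr (hform k₁ hk₁)
  have hordG : ∀ m ∈ G.support, d ≤ m.degree := by
    rw [hGdef, ← hod]; exact forall_le_degree_divMonomial ho
  obtain ⟨-, -, uN, hN, huN, hhN, hcoefN, hGN⟩ := stretch_ledger p hc hw hr0 hfloor hd1 hshade hform hdir hlam
    hprop hcarry htN0 htNk hjtN.symm hkeptN
  obtain ⟨-, -, uμ, hμ, huμ, hhμ, hcoefμ, hGμ⟩ := stretch_ledger p hc hw hr0 hfloor hd1 hshade hform hdir hlam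
    hprop hcarry htμ0 htμk hjtμ.symm hkeptμ
  obtain ⟨-, -, uν, hν, huν, hhν, hcoefν, hGν⟩ := stretch_ledger p hc hw hr0 hfloor hd1 hshade hform hdir hlam
    hprop hcarry htν0 htνk hjtν.symm hkeptν
  -- the COMMON Hasse letter `e` (K8)
  have hwit : coeff (Finsupp.single e d) G ≠ 0 := by
    rw [show coeff (Finsupp.single e d) G = coeff (Finsupp.single e d) (homogeneousComponent d G) by
      rw [coeff_homogeneousComponent, Finsupp.degree_single, if_pos rfl], hcone, coeff_C_mul,
      coeff_single_pow_linearForm]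
    exact mul_ne_zero ha₀ (pow_ne_zero _ hℓe)
  set H := hasseDeriv (Finsupp.single e (d - 1)) G with hHdef
  obtain ⟨vN, hvN, hHN⟩ := IsolatedBand.exists_unit_mul_mem_span_X_hasseDeriv_pow_of_mem p heN hd1 hdp hhN hGN
    huN (by rw [IsolatedBand.eval_hasseDeriv_single_one]; exact hcoefN e heN hℓe) hordG
    (Finsupp.single_eq_of_ne heN.symm) (Finsupp.degree_single e d) hwit
  obtain ⟨vμ, hvμ, hHμ⟩ := IsolatedBand.exists_unit_mul_mem_span_X_hasseDeriv_pow_of_mem p heμ hd1 hdp hhμ hGμ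
    huμ (by rw [IsolatedBand.eval_hasseDeriv_single_one]; exact hcoefμ e heμ hℓe) hordG
    (Finsupp.single_eq_of_ne heμ.symm) (Finsupp.degree_single e d) hwit
  obtain ⟨vν, hvν, hHν⟩ := IsolatedBand.exists_unit_mul_mem_span_X_hasseDeriv_pow_of_mem p heν hd1 hdp hhν hGν
    huν (by rw [IsolatedBand.eval_hasseDeriv_single_one]; exact hcoefν e heν hℓe) hordG
    (Finsupp.single_eq_of_ne heν.symm) (Finsupp.degree_single e d) hwit
  -- merge (K2 twice, then K22 (i))
  have hHNμ : H ∉ Ideal.span {(X N : MvPolynomial (Fin 4) K), X μ} :=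
    IsolatedBand.hasseDeriv_powerCone_not_mem_span_X_pair p heN heμ hd1 hdp ha₀ hℓe hcone
  have hHNν : H ∉ Ideal.span {(X N : MvPolynomial (Fin 4) K), X ν} :=
    IsolatedBand.hasseDeriv_powerCone_not_mem_span_X_pair p heN heν hd1 hdp ha₀ hℓe hcone
  have hHμν : H ∉ Ideal.span {(X μ : MvPolynomial (Fin 4) K), X ν} :=
    IsolatedBand.hasseDeriv_powerCone_not_mem_span_X_pair p heμ heν hd1 hdp ha₀ hℓe hcone
  set U := vN * vμ * vν with hUdef
  have hUN : U * G ∈ Ideal.span {(X N : MvPolynomial (Fin 4) K), H ^ d} := by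
    rw [show U * G = (vμ * vν) * (vN * G) by rw [hUdef]; ring]; exact Ideal.mul_mem_left _ _ hHN
  have hUμ : U * G ∈ Ideal.span {(X μ : MvPolynomial (Fin 4) K), H ^ d} := by
    rw [show U * G = (vN * vν) * (vμ * G) by rw [hUdef]; ring]; exact Ideal.mul_mem_left _ _ hHμ
  have hUν : U * G ∈ Ideal.span {(X ν : MvPolynomial (Fin 4) K), H ^ d} := by
    rw [show U * G = (vN * vμ) * (vν * G) by rw [hUdef]; ring]; exact Ideal.mul_mem_left _ _ hHν
  have h3 := mem_span_mul3_of_mem hμν ⟨hHNμ, hHNν, hHμν⟩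
    (IsolatedBand.mem_span_mul_of_mem_span_of_mem_span hNμ hHNμ hUN hUμ)
    (IsolatedBand.mem_span_mul_of_mem_span_of_mem_span hNν hHNν hUN hUν)
  obtain ⟨S, T, hST⟩ := Ideal.mem_span_pair.mp h3
  have hU : MvPolynomial.eval (0 : Fin 4 → K) U ≠ 0 := by
    rw [hUdef, map_mul, map_mul]; exact mul_ne_zero (mul_ne_zero hvN hvμ) hvν
  have hlinH : homogeneousComponent 1 H = C (a0 k₁ * d * ℓ k₁ e ^ (d - 1)) * (∑ i, C (ℓ k₁ i) * X i) :=
    homogeneousComponent_one_hasseDeriv_powerCone e hd1 hcone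
  have hHm : H ∈ originIdeal K := IsolatedBand.hasseDeriv_single_mem_originIdeal e hd2 hordG
  -- part 3 on the permuted triples
  have hfin : ∀ {N' B' C' : Fin 4}, N' ≠ B' → N' ≠ C' → B' ≠ C' → e ≠ N' → e ≠ B' → e ≠ C' →
      U * G = S * (X N' * X B' * X C') + T * H ^ d → 1 ≤ (c k₁).r B' → 1 ≤ (c k₁).r C' →
      b k₁ B' = 0 → b k₁ C' = 0 → j k₁ ≠ B' → j k₁ ≠ C' → False :=
    fun hN'B' hN'C' hB'C' heN' heB' heC' hG' hrB' hrC' hbB' hbC' hjB' hjC' =>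
      no_light_triple_tail p hc hw hr0 hfloor hd3 hdp hshade hform hdir hlam hprop hB'C' hk₁ hw3 hN'B' hN'C' heN'
        heB' heC' hU hHm hlinH hG' hrB' hrC' hre hℓe hbB' hbC' hjB' hjC'
  have hGNμν : U * G = S * (X N * X μ * X ν) + T * H ^ d := hST.symm
  have hGμNν : U * G = S * (X μ * X N * X ν) + T * H ^ d := by rw [hGNμν]; ring
  have hGνNμ : U * G = S * (X ν * X N * X μ) + T * H ^ d := by rw [hGNμν]; ring
  rcases hcov (j k₁) with hj | hj | hj | hj
  · obtain ⟨hbμ, hbν⟩ := hlaw1.1 hj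
    exact hfin hNμ hNν hμν heN heμ heν hGNμν hrμ hrν hbμ hbν (by rw [hj]; exact hNμ) (by rw [hj]; exact hNν)
  · obtain ⟨hbN, hbν⟩ := hlaw2.1 hj
    exact hfin hNμ.symm hμν hNν heμ heN heν hGμNν hrN hrν hbN hbν (by rw [hj]; exact hNμ.symm)
      (by rw [hj]; exact hμν)
  · obtain ⟨hbN, hbμ⟩ := hlaw3.1 hj
    exact hfin hNν.symm hμν.symm hNμ heν heN heμ hGνNμ hrN hrμ hbN hbμ (by rw [hj]; exact hNν.symm)
      (by rw [hj]; exact hμν.symm)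
  · obtain ⟨hnot, hN1⟩ := hlaw1.2 hj
    by_cases hbN : b k₁ N = 0
    · by_cases hbμ : b k₁ μ = 0
      · have hbν : b k₁ ν ≠ 0 := fun h => hnot ⟨hbN, hbμ, h⟩
        exact hfin hNν.symm hμν.symm hNμ heν heN heμ hGνNμ hrN hrμ hbN hbμ (by rw [hj]; exact heN)
          (by rw [hj]; exact heμ)
      · obtain ⟨-, hbν⟩ := (hlaw2.2 hj).2 hbμ
        exact hfin hNμ.symm hμν hNν heμ heN heν hGμNν hrN hrν hbN hbν (by rw [hj]; exact heN)
          (by rw [hj]; exact heν)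
    · obtain ⟨hbμ, hbν⟩ := hN1 hbN
      exact hfin hNμ hNν hμν heN heμ heν hGNμν hrμ hrν hbμ hbν (by rw [hj]; exact heμ) (by rw [hj]; exact heν)

end Chain

/-- **NO LIGHT TRIPLE REGIME at `p = 5`** (K25d): the light bound `5 ≤ r_X + r_Y + 3` is automatic for two letters of
positive weight, so at `p = 5` the (T3) branch of the `d = 3` light trichotomy carries no infinite isolated chain.
[OURS] [cite: CossartJannsenSaito2020, Thm. 3.10(4), Thm. 3.14, Thm. 9.3] -/
theorem no_light_triple_regime_of_born_five [CharP K 5] [DecidableEq K] {c : ℕ → State K} {j : ℕ → Fin 4}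
    {b : ℕ → Fin 4 → K} (hc : ∀ k, IsIsolated 5 (c k).F ∧ Step0 5 (c k) (c (k + 1)))
    (hw : FreeTail.IsWitnessedChain 5 c j b) (hr0 : ∀ e ∈ (c 0).F.support, (c 0).r ≤ e)
    (hfloor : ∀ k, ordZero (c k).F ≠ (5 : ℕ)) {k₀ d : ℕ} (hd3 : d = 3)
    (hshade : ∀ k, k₀ ≤ k → (c k).shade = (d : ℕ∞)) {ℓ : ℕ → Fin 4 → K} {a0 lam : ℕ → K}
    (hform : ∀ k, k₀ ≤ k → resForm (c k) = C (a0 k) * (∑ i, C (ℓ k i) * X i) ^ d)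
    (hdir : ∀ k, k₀ ≤ k → ℓ k (j k) + dotProduct (ℓ k) (b k) = 0) (hlam : ∀ k, k₀ ≤ k → lam k ≠ 0)
    (hprop : ∀ k, k₀ ≤ k → ∀ i, i ≠ j k → ℓ (k + 1) i = lam k * ℓ k i)
    (hcarry : ∀ k, k₀ ≤ k → ∃ i, i ≠ j k ∧ ℓ k i ≠ 0)
    (hB3 : ∀ k, k₀ ≤ k → (c k).r.support.card = 3) {k₁ : ℕ} (hk₁ : k₀ ≤ k₁)
    (hT3 : ∀ k, k₁ ≤ k → ∀ i, 1 ≤ (c k).r i →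
      ∃ t, k₀ ≤ t ∧ t < k ∧ j t = i ∧ ∀ m, t < m → m < k → j m ≠ i ∧ b m i = 0) : False := by
  haveI : Fact (Nat.Prime 5) := ⟨by norm_num⟩
  exact no_light_triple_regime_of_born 5 hc hw hr0 hfloor hd3 (by omega) hshade hform hdir hlam hprop hcarry hB3 hk₁
    (fun k _ i₁ i₂ _ h1 h2 => by omega) hT3


end ResCone

end Summit.ResolutionOfSingularities.ResolutionOfSingularities.Theorems.PIDim4

end
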